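import Summits.BirchSwinnertonDyer.Rank1Residual.ManinAdditive.KummerDiamondShapeLaws
import Literature.NumberTheory.EllipticCurves.CuspFormLFunctionLevelConductorProofs
import HarnessLib
import HarnessLib.Audit.Tags

/-!
# The local (modularity-free) form of E-es-186 and the reduction of C2 to E-es-185 ∧ E-es-186♭
(cell `bsd-f2-manin`, seat `-es` g38, MEMO-es §59.13; by name against the LANDED module
`KummerDiamondShapeLaws` (p757011) / `…Split` (p757067))

* **E-es-186♭ `FreyTwistShapeConductorExponentTwoLaw`** (support, MODULARITY-FREE; a target for a
  prover with the tree's `TateAlgorithmIstarCharTwoProofs` machinery): a curve with the Frey-twist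
  shape `y² = x(x − 2s²)(x − t²)`, `s` even, `t` odd, has `ord₂(N_W) = 4`.  Paper proof
  (§59.13(c)): after `y ↦ y + x` the model `y² + 2xy = x³ + 2βx² + 2^M δ x` (`β, δ` odd,
  `M = 2v₂(s)+1 ≥ 3`, `a₃ = a₆ = 0`, `ord₂Δ = 2M+4`) runs through Step 7 of Tate's algorithm into
  the `Iₙ*` loop; every `Y`-round is `Y²`, the `X`-round with `a₄/2^j` exits exactly at `j = M`:
  type `I*_{2M−4} = I*_{4v₂(s)−2}`, `f₂ = ord Δ + 1 − (n + 5) = 4` ("family C", next to the tree's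
  `kodairaSymbolOfMinimal_familyA/B`).  Data: E38 B1 894/894 (kit j337520, j337653).
* PROVED glue: `freyTwistShapeTwoAdicLaw_of_local : 186♭ → exists_isNewformOf → FreyTwistShapeTwoAdicLaw`
  (level = conductor by the tree theorem `IsNewformOf.level_eq_conductorNorm_of_exists_isNewformOf`)
  and `maninOddAtFour_of_CDT_shape_local : CDT → E-es-185 → 186♭ → exists_isNewformOf → C2` (the latter PROVED in the cone
  sibling `KummerDiamondShapeLawsSplit.lean`, see the typer note).

References: J. H. Silverman, *ATAEC* IV.9.4 (Tate's algorithm), IV.11.1 (Ogg) [SilvermanATAEC1994];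
H. Carayol 1986 (level = conductor) [Carayol1986].

TYPER NOTE (typer g21, T-es-73).  SOURCE = HOME/es/g38/KummerDiamondLocalTwoAdic-es-g38.lean sha16 ea70b936f0206045 (66 l.; es: farm rc 0·0·0·0,
axioms standard; BC7 186♭ 4/4 CLEAN Probe-es-g38.verdicts.txt 027cfa43a08d739e; MEMO-es §59.13) VERBATIM, SPLIT BY IMPORT CONE exactly as
T-es-72: the source imports the cone sibling `KummerDiamondShapeLawsSplit`; THIS LEAF imports the route-independent leaf `KummerDiamondShapeLaws`
(p757011) + Literature `CuspFormLFunctionLevelConductorProofs` instead and keeps the support row E-es-186♭ `FreyTwistShapeConductorExponentTwoLaw`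
(plain def) and the two cone-free glue theorems `freyTwistShapeTwoAdicLaw_of_local` (186♭ ∧ modularity ⊢ 186) and
`shimuraIndexNeFourAtFour_of_shape_local` (⊢ E-an-152b); the ONE route-naming composition `maninOddAtFour_of_CDT_shape_local : CDT →
exists_isNewformOf → 185 → 186♭ → Theses.ManinLocalTwoThree.ManinOddAtFour` is APPENDED verbatim to the cone sibling
`KummerDiamondShapeLawsSplit.lean` (which gains `import …KummerDiamondLocalTwoAdic`).  No other change; cite key `SilvermanATAEC1994` in bib.
REFUTER: ref1/ref2 R-es-87 PENDING.  No instances, no notation, no sorry.  bears_on: stmt-BirchSwinnertonDyer-22967 (C2 «⟸ CDT ∧ hnf ∧ 185 ∧ 186♭»,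
priced per the director's 00:56Z freeze).  BSD is not proved by this; Manin c = 1 not proved; C2/C3 OPEN.
-/

open WeierstrassCurve Literature.NumberTheory.EllipticCurves Literature.NumberTheory.EllipticCurves.ModularForms

namespace Summit.BirchSwinnertonDyer.Rank1Residual.ManinAdditive.KummerDiamond

/-- **E-es-186♭** `FreyTwistShapeConductorExponentTwoLaw` (support; local, modularity-free): a curve
with the Frey-twist shape has conductor exponent `4` at `2` (Tate's algorithm, "family C":
`I*_{4v₂(s)−2}`, `ord₂Δ = 4v₂(s)+6`). [cite: SilvermanATAEC1994, IV.9.4 and IV.11.1] -/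
def FreyTwistShapeConductorExponentTwoLaw : Prop :=
  ∀ (W : WeierstrassCurve ℚ) [W.IsElliptic], HasFreyTwistShape W → (W.conductorNorm ℤ).factorization 2 = 4

/-- **E-es-186 ⟸ E-es-186♭ ∧ modularity** (`exists_isNewformOf`; level = conductor via the tree
theorem `IsNewformOf.level_eq_conductorNorm_of_exists_isNewformOf`). PROVED glue. -/
theorem freyTwistShapeTwoAdicLaw_of_local (hloc : FreyTwistShapeConductorExponentTwoLaw)
    (hnf : exists_isNewformOf) : FreyTwistShapeTwoAdicLaw := by
  intro W₀ _ N _ D₀ hshape h32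
  have hN : N = W₀.conductorNorm ℤ :=
    IsNewformOf.level_eq_conductorNorm_of_exists_isNewformOf hnf D₀.isNewformOf
  have hf : (W₀.conductorNorm ℤ).factorization 2 = 4 := hloc W₀ hshape
  have hne : N ≠ 0 := NeZero.ne N
  have h5 : 5 ≤ N.factorization 2 :=
    (Nat.Prime.pow_dvd_iff_le_factorization Nat.prime_two hne).mp h32
  rw [hN] at h5
  omega

/-- **E-an-152b ⟸ modularity ∧ E-es-185 ∧ E-es-186♭** (CDT-free, cone-free statement). -/
theorem shimuraIndexNeFourAtFour_of_shape_local (hnf : exists_isNewformOf)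
    (h185 : IndexFourForcesFreyTwistShape) (h186loc : FreyTwistShapeConductorExponentTwoLaw) :
    ShimuraKernel.ShimuraIndexNeFourAtFour :=
  shimuraIndexNeFourAtFour_of_shape_laws h185 (freyTwistShapeTwoAdicLaw_of_local h186loc hnf)

end Summit.BirchSwinnertonDyer.Rank1Residual.ManinAdditive.KummerDiamond
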